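import Summits.QuantumFields.YangMills.Theorems.LangevinControlUVOSLegsAtWeakCouplingCInheritedAmplitudeGatesDefs
import Summits.QuantumFields.YangMills.Theorems.LangevinControlUVOSLegsFromFemtoAndGapStubLower
import HarnessLib

/-!
# Stub `stub_lowerI` of line `inherited-amplitude-gates` (crux `OSLegsAtWeakCouplingC`, stmt-QuantumFields-16207):
# the three-point half of `LowerBounds` from `FBL` + the absolute clause (U) of `FC2I` + `FC3`

Helper file for the registered stub `stub_lowerI` of the skeleton `Cruxes/OSLegsAtWeakCouplingC/Lines/inherited_amplitude_gates.lean`: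
the landed three-point half `StubLower.lowerBounds_threePoint` of `stub_lower` (line `dlr-collar-transfer`) re-run with the
INHERITED package `FC2I` in place of `FC2`.  FC2's sandwich entered the three-point transfer only through the bound
`|kerCov(dens u, dens u')| ≤ C₂⁺ (a/(s Vmin))⁸` on the mixed terms of the law of total cumulance (`cov_abs_bound`); here it
comes from `FC2I`'s ABSOLUTE clause (U) `|ν⁸ kerCov_η| ≤ C₂` (`cov_abs_boundI`) with the CONSTANT collar `κ₂` (depth budget
`T = κ₂ s Vmax + K₃(s/2) s`; smallness `s Vmax κ₂ < ℓ/10` from `s ≤ ℓ/(100 (Vmax+1)(κ₂+1))`, `scale_boundsI`).  FC3 and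
everything else (`M3_bound`, `femto_budget3`, `shape_constants`, `centre_cover`, `k3_triple_lower`, `half_signal3`,
`k3_floor_of_shape`, `shape_bound`, `pair_separation_centres`, `cube_radius_general`, bumps, Riemann mass) are used by name:
`triple_floorI` (per-triple signed floor `σ · torusK3 ≥ (c₃ M₃ / (2 s⁸)) a¹²`), `lowerBoundsI_threePoint` (the sub-goal).
-/

set_option autoImplicit false

noncomputable section

open scoped SchwartzMap BigOperators
open MeasureTheory Filter Topology Metric
open Literature.MathematicalPhysics.QuantumFieldTheory Literature.MathematicalPhysics.QuantumLattice
open Literature.MathematicalPhysics.AQFT Literature.Probability.LatticeModels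
open Summit.QuantumFields.YangMills.Cruxes.OSLegsFromFemtoAndGap.DlrCollarTransfer
open Summit.QuantumFields.YangMills.Cruxes.OSLegsFromFemtoAndGap.DlrCollarTransfer.StubLower
open Summit.QuantumFields.YangMills.Theorems.OSLegsFromFemtoAndGap.StubLower

namespace Summit.QuantumFields.YangMills.Cruxes.OSLegsAtWeakCouplingC.InheritedAmplitudeGates.StubLowerI

/-! ### Real-arithmetic bookkeeping -/

/-- The absolute clause (U) `|ν⁸ κ| ≤ C₂` bounds the conditional covariance `κ` by `C₂⁺ (α/t)⁸` at separations
`ν α ≥ t` (replaces `cov_abs_bound`). [folklore] -/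
theorem cov_abs_boundI {C₂ ν κ α t : ℝ} (ht : 0 < t) (hα : 0 < α) (hν : t ≤ ν * α)
    (hU : |ν ^ 8 * κ| ≤ C₂) : |κ| ≤ max C₂ 0 * (α / t) ^ 8 := by
  have hν0 : 0 < ν := by by_contra h; push Not at h; nlinarith
  have h1 : ν ^ 8 * |κ| ≤ max C₂ 0 := by
    rw [abs_mul, abs_of_nonneg (by positivity : (0 : ℝ) ≤ ν ^ 8)] at hU
    exact hU.trans (le_max_left _ _)
  have h2 : |κ| ≤ max C₂ 0 / ν ^ 8 := by
    rw [le_div_iff₀ (by positivity)]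
    have e := mul_comm (ν ^ 8) |κ|
    linarith only [h1, e]
  refine h2.trans ?_
  rw [div_eq_mul_inv, ← inv_pow]
  refine mul_le_mul_of_nonneg_left (pow_le_pow_left₀ (inv_nonneg.2 hν0.le) ?_ 8) (le_max_right _ _)
  rw [inv_le_comm₀ hν0 (by positivity), inv_div, div_le_iff₀ hα]
  exact hν

/-- Smallness of the three-point scale: with `smax = ℓ/(100 (Vmax+1)(k+1))` and `0 ≤ s ≤ smax`:
`s ≤ ℓ/100`, `s Vmax ≤ ℓ/100` and `s Vmax k < ℓ/10`. [folklore] -/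
theorem scale_boundsI {ℓ Vmax k s smax : ℝ} (hℓ : 0 < ℓ) (hV : 0 ≤ Vmax) (hk : 0 ≤ k) (hs0 : 0 ≤ s)
    (hsmax : smax = ℓ / (100 * (Vmax + 1) * (k + 1))) (hs : s ≤ smax) :
    s ≤ ℓ / 100 ∧ s * Vmax ≤ ℓ / 100 ∧ s * Vmax * k < ℓ / 10 := by
  have hV1 : Vmax + 1 ≠ 0 := by positivity
  have hk1 : k + 1 ≠ 0 := by positivity
  have hP : smax * ((Vmax + 1) * (k + 1)) = ℓ / 100 := by rw [hsmax]; field_simp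
  have hsm0 : 0 ≤ smax := hs0.trans hs
  have h1 : (1 : ℝ) ≤ (Vmax + 1) * (k + 1) := by nlinarith
  have hA : s ≤ ℓ / 100 := by
    have : smax ≤ smax * ((Vmax + 1) * (k + 1)) := le_mul_of_one_le_right hsm0 h1
    linarith
  have hB : s * Vmax ≤ ℓ / 100 := by
    have h2 : Vmax ≤ (Vmax + 1) * (k + 1) := by nlinarith
    have : s * Vmax ≤ smax * ((Vmax + 1) * (k + 1)) := mul_le_mul hs h2 hV hsm0
    linarith
  have hC : s * Vmax * k < ℓ / 10 := by
    have h2 : Vmax * k ≤ (Vmax + 1) * (k + 1) := by nlinarith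
    have : s * (Vmax * k) ≤ smax * ((Vmax + 1) * (k + 1)) := mul_le_mul hs h2 (mul_nonneg hV hk) hsm0
    rw [mul_assoc]; linarith
  exact ⟨hA, hB, hC⟩

section TripleFloor

variable (G : Type) [Group G] [TopologicalSpace G] [IsTopologicalGroup G] [CompactSpace G]
  [MeasurableSpace G] [BorelSpace G] (r : LatticeRep G) (a : ℝ → ℝ)

/-- **The per-triple signed cumulant floor from FBL + `FC2I` (U) + FC3.**  At a physical scale `s` chosen inside
the growth clauses of FC3, for every coupling past the thresholds with `a(β)` small and every torus covering the
femto cube, every triple `x, y, z` read by the three bumps (at `0`, `s v⃗`, `s w⃗`, radius `δs/4`) has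
`σ · torusK3(x, y, z) ≥ (c₃ M₃ / (2 s⁸)) a¹²` (`triple_floor` with the constant collar `κ₂` and `cov_abs_boundI`).
[folklore] -/
theorem triple_floorI
    {C₁ β₁ ℓ₁ : ℝ} {p : ℝ → ℝ} (hC₁ : 0 ≤ C₁)
    (hFBL : ∀ β : ℝ, β₁ ≤ β → ∀ (c : Fin 4 → ℤ) (b : ℕ), (b : ℝ) * a β ≤ ℓ₁ →
      ∀ (η : LGConfig 4 G) (x : Fin 4 → ℤ), 2 ≤ depth c b x →
        |kerE G r β c b η (dens G r x) - p β| ≤ C₁ / (depth c b x : ℝ) ^ 4)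
    {β₂ ℓ₂ C₂ : ℝ} {κ₂ n₀ : ℕ}
    (hU : ∀ β : ℝ, β₂ ≤ β → ∀ (c : Fin 4 → ℤ) (b : ℕ), (b : ℝ) * a β ≤ ℓ₂ →
      ∀ (η : LGConfig 4 G) (x y : Fin 4 → ℤ), (n₀ : ℝ) ≤ ‖siteToE (y - x)‖ →
        (κ₂ : ℝ) * ‖siteToE (y - x)‖ ≤ depth c b x → (κ₂ : ℝ) * ‖siteToE (y - x)‖ ≤ depth c b y →
          |‖siteToE (y - x)‖ ^ 8 * kerCov G r β c b η (dens G r x) (dens G r y)| ≤ C₂)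
    {v w : EuclideanSpace ℝ (Fin 4)} {σ δ : ℝ} {Γ₃ : ℝ → ℝ} {β₃ ℓ₃ c₃ : ℝ} {K₃ : ℝ → ℝ} {n₃ : ℕ}
    (hσ : σ = 1 ∨ σ = -1) (hδ : 0 < δ) (hc₃ : 0 < c₃) (hK₃1 : ∀ s, 1 ≤ K₃ s)
    (hFC3 : ∀ β : ℝ, β₃ ≤ β → ∀ (c : Fin 4 → ℤ) (b : ℕ), (b : ℝ) * a β ≤ ℓ₃ →
      ∀ (η : LGConfig 4 G) (n : ℕ) (x y z : Fin 4 → ℤ) (s₀ : ℝ), 0 < s₀ → s₀ ≤ (n : ℝ) * a β →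
        n₃ ≤ n → ‖siteToE (y - x) - (n : ℝ) • v‖ ≤ δ * n → ‖siteToE (z - x) - (n : ℝ) • w‖ ≤ δ * n →
          K₃ s₀ * n ≤ depth c b x → K₃ s₀ * n ≤ depth c b y → K₃ s₀ * n ≤ depth c b z →
            c₃ * Γ₃ ((n : ℝ) * a β) ≤ σ * (n : ℝ) ^ 12 * kerK3 G r β c b η x y z)
    {s D M₃ δ₃ Vmin Vmax : ℝ} (hs : 0 < s) (hD : 0 < D) (hM₃ : 0 ≤ M₃) (hVmin : 0 < Vmin)
    (hVv : Vmin ≤ ‖v‖ - δ / 2) (hVw : Vmin ≤ ‖w‖ - δ / 2) (hVvw : Vmin ≤ ‖w - v‖ - δ / 2)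
    (hVv' : ‖v‖ + δ / 2 ≤ Vmax) (hVw' : ‖w‖ + δ / 2 ≤ Vmax) (hVvw' : ‖w - v‖ + δ / 2 ≤ Vmax)
    (hΓ₃M : ∀ t : ℝ, 0 < t → t < δ₃ → M₃ < Γ₃ t / t ^ 4) (hsδ₃ : s < δ₃)
    (hM₃C : 6 * C₁ * max C₂ 0 / (D ^ 4 * (s * Vmin) ^ 8) + 8 * C₁ ^ 3 / D ^ 12 ≤
      c₃ * M₃ / (2 * s ^ 8))
    {β : ℝ} (hβ₁ : β₁ ≤ β) (hβ₂ : β₂ ≤ β) (hβ₃ : β₃ ≤ β) (hα : 0 < a β)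
    (hαn₀ : (n₀ : ℝ) * a β ≤ s * Vmin) (hαn₃ : ((n₃ : ℝ) + 1) * a β ≤ s) (hα2 : a β ≤ s / 2)
    (hαv : a β * (‖v‖ + δ) ≤ δ * s / 2) (hαw : a β * (‖w‖ + δ) ≤ δ * s / 2)
    (hfem₁ : 2 * ((κ₂ : ℝ) * (s * Vmax) + K₃ (s / 2) * s + D + s * Vmax) + 7 * a β ≤ ℓ₁)
    (hfem₂ : 2 * ((κ₂ : ℝ) * (s * Vmax) + K₃ (s / 2) * s + D + s * Vmax) + 7 * a β ≤ ℓ₂)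
    (hfem₃ : 2 * ((κ₂ : ℝ) * (s * Vmax) + K₃ (s / 2) * s + D + s * Vmax) + 7 * a β ≤ ℓ₃)
    {L : ℕ} (hL : (κ₂ : ℝ) * (s * Vmax) + K₃ (s / 2) * s + D + s * Vmax + 4 * a β ≤ a β * L)
    (x y z : Fin 4 → ℤ) (hx : ‖a β • siteToE x‖ < δ * s / 4)
    (hy : ‖a β • siteToE y - s • v‖ < δ * s / 4) (hz : ‖a β • siteToE z - s • w‖ < δ * s / 4) :
    c₃ * M₃ / (2 * s ^ 8) * a β ^ 12 ≤ σ * torusK3 G r β L x y z := by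
  have hx' : ‖a β • siteToE x - 0‖ < δ * s / 4 := by rwa [sub_zero]
  have hK0 : (0 : ℝ) ≤ κ₂ := Nat.cast_nonneg _
  have hK₃0 : 0 ≤ K₃ (s / 2) := by linarith only [hK₃1 (s / 2)]
  have hVmax : 0 ≤ Vmax := by linarith only [norm_nonneg v, hVv', hδ]
  have hsV : 0 < s * Vmin := mul_pos hs hVmin
  -- separations of the three pairs
  have hns : ∀ u : EuclideanSpace ℝ (Fin 4), ‖s • u‖ = s * ‖u‖ := fun u => by
    rw [norm_smul, Real.norm_eq_abs, abs_of_pos hs]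
  have nv : ‖s • v - (0 : EuclideanSpace ℝ (Fin 4))‖ = s * ‖v‖ := by rw [sub_zero, hns]
  have nw : ‖s • w - (0 : EuclideanSpace ℝ (Fin 4))‖ = s * ‖w‖ := by rw [sub_zero, hns]
  have nwv : ‖s • w - s • v‖ = s * ‖w - v‖ := by rw [← smul_sub, hns]
  obtain ⟨hxy0, hxy1, hxy2⟩ := pair_separation_centres hα x y hx' hy
  obtain ⟨hxz0, hxz1, hxz2⟩ := pair_separation_centres hα x z hx' hz
  obtain ⟨-, hyz1, hyz2⟩ := pair_separation_centres hα y z hy hz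
  rw [nv] at hxy1 hxy2
  rw [nw] at hxz1 hxz2
  rw [nwv] at hyz1 hyz2
  rw [sub_zero] at hxy0 hxz0
  have hv1 := mul_le_mul_of_nonneg_left hVv hs.le
  have hv2 := mul_le_mul_of_nonneg_left hVv' hs.le
  have hw1 := mul_le_mul_of_nonneg_left hVw hs.le
  have hw2 := mul_le_mul_of_nonneg_left hVw' hs.le
  have hvw1 := mul_le_mul_of_nonneg_left hVvw hs.le
  have hvw2 := mul_le_mul_of_nonneg_left hVvw' hs.le
  have hsxy : s * Vmin < ‖siteToE (y - x)‖ * a β ∧ ‖siteToE (y - x)‖ * a β < s * Vmax :=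
    ⟨by linarith only [hv1, hxy1], by linarith only [hv2, hxy2]⟩
  have hsxz : s * Vmin < ‖siteToE (z - x)‖ * a β ∧ ‖siteToE (z - x)‖ * a β < s * Vmax :=
    ⟨by linarith only [hw1, hxz1], by linarith only [hw2, hxz2]⟩
  have hsyz : s * Vmin < ‖siteToE (z - y)‖ * a β ∧ ‖siteToE (z - y)‖ * a β < s * Vmax :=
    ⟨by linarith only [hvw1, hyz1], by linarith only [hvw2, hyz2]⟩
  have hshy' : ‖a β • siteToE (y - x) - s • v‖ < δ * s / 2 := by linarith only [hxy0]
  have hshz' : ‖a β • siteToE (z - x) - s • w‖ < δ * s / 2 := by linarith only [hxz0]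
  -- FC3's shape `n = ⌊s/α⌋`
  obtain ⟨n, hn1, hn2⟩ : ∃ n : ℕ, (n : ℝ) * a β ≤ s ∧ s < (n + 1) * a β := by
    refine ⟨⌊s / a β⌋₊, ?_, ?_⟩
    · rw [← le_div_iff₀ hα]; exact Nat.floor_le (by positivity)
    · rw [← div_lt_iff₀ hα]; exact Nat.lt_floor_add_one _
  have hnα : 0 < (n : ℝ) * a β := by linarith only [hn2, hα2, hs]
  have hn0 : 0 < (n : ℝ) := pos_of_mul_pos_left hnα hα.le
  have hn₃n : n₃ ≤ n := by
    have : (n₃ : ℝ) < n := lt_of_mul_lt_mul_right (by linarith only [hαn₃, hn2] : (n₃ : ℝ) * a β < n * a β) hα.le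
    exact_mod_cast this.le
  have hs₀ : s / 2 ≤ n * a β := by linarith only [hn2, hα2]
  have hnδ₃ : (n : ℝ) * a β < δ₃ := hn1.trans_lt hsδ₃
  have hns : (n : ℝ) ≤ s / a β := by rw [le_div_iff₀ hα]; exact hn1
  have hshy : ‖siteToE (y - x) - (n : ℝ) • v‖ ≤ δ * n := shape_bound hα hδ x y hshy' hαv hn1 hn2
  have hshz : ‖siteToE (z - x) - (n : ℝ) • w‖ ≤ δ * n := shape_bound hα hδ x z hshz' hαw hn1 hn2
  -- the depth budget `Dep = (T + D)/α + 3`, `T = κ₂ s Vmax + K₃(s/2) s`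
  have hKK : 0 ≤ (κ₂ : ℝ) * (s * Vmax) := mul_nonneg hK0 (mul_nonneg hs.le hVmax)
  have hKK₃ : 0 ≤ K₃ (s / 2) * s := mul_nonneg hK₃0 hs.le
  have hT0 : 0 ≤ (κ₂ : ℝ) * (s * Vmax) + K₃ (s / 2) * s := add_nonneg hKK hKK₃
  obtain ⟨Dep, hDep⟩ : ∃ Dep : ℝ, Dep = ((κ₂ : ℝ) * (s * Vmax) + K₃ (s / 2) * s + D) / a β + 3 := ⟨_, rfl⟩
  have hP : 0 ≤ ((κ₂ : ℝ) * (s * Vmax) + K₃ (s / 2) * s + D) / a β := div_nonneg (by linarith only [hT0, hD]) hα.le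
  have hDep2 : (2 : ℝ) ≤ Dep := by rw [hDep]; linarith only [hP]
  have hDep0 : 0 < Dep := by linarith only [hDep2]
  have hKdep : (κ₂ : ℝ) * (s * Vmax / a β) ≤ Dep := by
    rw [hDep, ← mul_div_assoc]
    have : (κ₂ : ℝ) * (s * Vmax) / a β ≤ ((κ₂ : ℝ) * (s * Vmax) + K₃ (s / 2) * s + D) / a β :=
      div_le_div_of_nonneg_right (by linarith only [hKK₃, hD]) hα.le
    linarith only [this]
  have hK₃dep : K₃ (s / 2) * (s / a β) ≤ Dep := by
    rw [hDep, ← mul_div_assoc]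
    have : K₃ (s / 2) * s / a β ≤ ((κ₂ : ℝ) * (s * Vmax) + K₃ (s / 2) * s + D) / a β :=
      div_le_div_of_nonneg_right (by linarith only [hKK, hD]) hα.le
    linarith only [this]
  have hDa : D / a β ≤ Dep := by
    have : D / a β ≤ ((κ₂ : ℝ) * (s * Vmax) + K₃ (s / 2) * s + D) / a β := div_le_div_of_nonneg_right (by linarith only [hT0]) hα.le
    rw [hDep]; linarith only [this]
  have hK₃ν : K₃ (s / 2) * n ≤ Dep := (mul_le_mul_of_nonneg_left hns hK₃0).trans hK₃dep
  have hKν : ∀ {t : ℝ}, t * a β < s * Vmax → (κ₂ : ℝ) * t ≤ Dep := fun {t} ht => by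
    have : t ≤ s * Vmax / a β := by rw [le_div_iff₀ hα]; exact ht.le
    exact (mul_le_mul_of_nonneg_left this hK0).trans hKdep
  -- the cube of radius `R` around `x`
  obtain ⟨R, hR1, hRL, hRν, hfem⟩ :=
    cube_radius_general (T := (κ₂ : ℝ) * (s * Vmax) + K₃ (s / 2) * s) (νb := s * Vmax) hα hT0 hD (by positivity) hL
  obtain ⟨hνyR, hDy⟩ := hRν ‖siteToE (y - x)‖ hsxy.2.le
  obtain ⟨hνzR, hDz⟩ := hRν ‖siteToE (z - x)‖ hsxz.2.le
  obtain ⟨-, hDx⟩ := hRν 0 (by rw [zero_mul]; positivity)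
  rw [← hDep] at hDx hDy hDz
  have hyx : ∀ j, |y j - x j| + 1 ≤ (R : ℤ) := fun j => by
    have h3 : ((|y j - x j| + 1 : ℤ) : ℝ) ≤ R := by push_cast; linarith only [abs_sub_le_norm_siteToE x y j, hνyR]
    exact_mod_cast h3
  have hzx : ∀ j, |z j - x j| + 1 ≤ (R : ℤ) := fun j => by
    have h3 : ((|z j - x j| + 1 : ℤ) : ℝ) ≤ R := by push_cast; linarith only [abs_sub_le_norm_siteToE x z j, hνzR]
    exact_mod_cast h3
  -- the cube is femto
  have hb : ((2 * R + 1 : ℕ) : ℝ) * a β ≤ 2 * ((κ₂ : ℝ) * (s * Vmax) + K₃ (s / 2) * s + D + s * Vmax) + 7 * a β := by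
    push_cast; exact hfem
  have hb₁ := hb.trans hfem₁
  have hb₂ := hb.trans hfem₂
  have hb₃ := hb.trans hfem₃
  -- depths of the three sites (no linear arithmetic on big contexts past this point)
  have hdx0 := le_depth_cube x x R (t := 0) (fun j => by simp)
  have hdx : Dep ≤ (depth (fun j => x j - R) (2 * R + 1) x : ℝ) := hDx.trans hdx0
  have hdy : Dep ≤ (depth (fun j => x j - R) (2 * R + 1) y : ℝ) :=
    hDy.trans (le_depth_cube x y R fun j => abs_sub_le_norm_siteToE x y j)
  have hdz : Dep ≤ (depth (fun j => x j - R) (2 * R + 1) z : ℝ) :=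
    hDz.trans (le_depth_cube x z R fun j => abs_sub_le_norm_siteToE x z j)
  -- FC2I (U): the three conditional covariances are small
  have hcov : ∀ u u' : Fin 4 → ℤ, s * Vmin < ‖siteToE (u' - u)‖ * a β →
      ‖siteToE (u' - u)‖ * a β < s * Vmax →
      Dep ≤ (depth (fun j => x j - R) (2 * R + 1) u : ℝ) →
      Dep ≤ (depth (fun j => x j - R) (2 * R + 1) u' : ℝ) →
      ∀ η, |kerCov G r β (fun j => x j - R) (2 * R + 1) η (dens G r u) (dens G r u')| ≤
        max C₂ 0 * (a β / (s * Vmin)) ^ 8 := by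
    intro u u' h1 h2 hu hu' η
    have hn₀ν : (n₀ : ℝ) ≤ ‖siteToE (u' - u)‖ := le_of_mul_le_mul_right (hαn₀.trans h1.le) hα
    exact cov_abs_boundI hsV hα h1.le
      (hU β hβ₂ (fun j => x j - R) (2 * R + 1) hb₂ η u u' hn₀ν ((hKν h2).trans hu) ((hKν h2).trans hu'))
  -- FC3: the signed floor
  have hfl : ∀ η, c₃ * M₃ / s ^ 8 * a β ^ 12 ≤
      σ * kerK3 G r β (fun j => x j - R) (2 * R + 1) η x y z := fun η => by
    have h := hFC3 β hβ₃ (fun j => x j - R) (2 * R + 1) hb₃ η n x y z (s / 2)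
      (half_pos hs) hs₀ hn₃n hshy hshz (hK₃ν.trans hdx) (hK₃ν.trans hdy) (hK₃ν.trans hdz)
    have h' : c₃ * Γ₃ (n * a β) ≤ (n : ℝ) ^ 12 * (σ * kerK3 G r β (fun j => x j - R) (2 * R + 1) η x y z) :=
      h.trans_eq (by ring)
    exact k3_floor_of_shape hc₃ hM₃ hn0 hα hn1 (hΓ₃M _ hnα hnδ₃) h'
  -- FBL: the boundary law at depth `≥ D/α`
  have hh : ∀ u : Fin 4 → ℤ, Dep ≤ (depth (fun j => x j - R) (2 * R + 1) u : ℝ) →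
      ∀ η, |kerE G r β (fun j => x j - R) (2 * R + 1) η (dens G r u) - p β| ≤
        C₁ * (a β / D) ^ 4 := by
    intro u hu η
    have h2u : 2 ≤ depth (fun j => x j - R) (2 * R + 1) u := by
      have : (2 : ℝ) ≤ depth (fun j => x j - R) (2 * R + 1) u := hDep2.trans hu
      exact_mod_cast this
    exact boundary_of_depth hC₁ hD hα (hDep0.trans_le hu) (hDa.trans hu)
      (hFBL β hβ₁ _ _ hb₁ η u h2u)
  -- law of total cumulance
  exact half_signal3 hD hα hs hVmin hM₃C
    (k3_triple_lower G r β x y z R L hRL hR1 hyx hzx hσ (hh x hdx) (hh y hdy) (hh z hdz)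
      (hcov y z hsyz.1 hsyz.2 hdy hdz) (hcov x z hsxz.1 hsxz.2 hdx hdz)
      (hcov x y hsxy.1 hsxy.2 hdx hdy) hfl)

end TripleFloor

/-- **The three-point half of `LowerBounds` from `FBL` + `FC2I` (U) + `FC3`** (sub-goal of `stub_lowerI`): three real
bumps `f, g, h` with pairwise disjoint supports (at `0`, `s v⃗`, `s w⃗`, radius `δ s/4`) and `ε > 0` with
`|Q3(f, g, h)| ≥ ε` on every large torus at every large coupling. [folklore] -/
theorem lowerBoundsI_threePoint : ∀ (G : Type) [Group G] [TopologicalSpace G] [IsTopologicalGroup G] [CompactSpace G] [MeasurableSpace G] [BorelSpace G] (r : LatticeRep G) (a : ℝ → ℝ), (∀ β, 0 < a β) → Filter.Tendsto a Filter.atTop (nhds 0) → FBL G r a → FC2I G r a → FC3 G r a → ∃ (f g h : 𝓢(EuclideanSpace ℝ (Fin 4), ℝ)) (ε β₅ Λ₅ : ℝ), Disjoint (tsupport f) (tsupport g) ∧ Disjoint (tsupport g) (tsupport h) ∧ Disjoint (tsupport f) (tsupport h) ∧ 0 < ε ∧ ∀ β : ℝ, β₅ ≤ β → ∀ L : ℕ,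 Λ₅ ≤ a β * L → ε ≤ |Q3 G r β L (a β) f g h| := by
  intro G _ _ _ _ _ _ r a hapos hlim hFBL hFC2I hFC3
  obtain ⟨C₁, β₁, ℓ₁, p, hℓ₁, hC₁, hFBLc⟩ := hFBL
  obtain ⟨β₂, ℓ₂, C₂, κ₂, n₀, hℓ₂, hn₀, hU, -⟩ := hFC2I
  obtain ⟨v, w, σ, δ, Γ₃, β₃, ℓ₃, c₃, K₃, n₃, hσ, hδ, h2v, h2w, h2vw, hℓ₃, hc₃, hK₃1, hK₃lim, -, -,
    -, hΓ₃lim, hFC3c⟩ := hFC3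
  -- the constants
  obtain ⟨ℓ, hℓ⟩ : ∃ ℓ : ℝ, ℓ = min (min ℓ₁ ℓ₂) ℓ₃ := ⟨_, rfl⟩
  have hℓ0 : 0 < ℓ := by rw [hℓ]; exact lt_min (lt_min hℓ₁ hℓ₂) hℓ₃
  have hℓℓ₁ : ℓ ≤ ℓ₁ := hℓ ▸ (min_le_left _ _).trans (min_le_left _ _)
  have hℓℓ₂ : ℓ ≤ ℓ₂ := hℓ ▸ (min_le_left _ _).trans (min_le_right _ _)
  have hℓℓ₃ : ℓ ≤ ℓ₃ := hℓ ▸ min_le_right _ _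
  obtain ⟨Vmin, Vmax, hVmin, hVmax, -, hVv, hVw, hVvw, hVv', hVw', hVvw', hδV⟩ :=
    shape_constants hδ h2v h2w h2vw
  obtain ⟨D, hD⟩ : ∃ D : ℝ, D = ℓ / 100 := ⟨_, rfl⟩
  have hD0 : 0 < D := by rw [hD]; positivity
  have hκ₂0 : (0 : ℝ) ≤ κ₂ := Nat.cast_nonneg _
  obtain ⟨smax, hsmax⟩ : ∃ smax : ℝ, smax = ℓ / (100 * (Vmax + 1) * ((κ₂ : ℝ) + 1)) := ⟨_, rfl⟩
  have hsmax0 : 0 < smax := by rw [hsmax]; positivity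
  have hC₂p : 0 ≤ max C₂ 0 := le_max_right _ _
  obtain ⟨M₃, hM₃⟩ : ∃ M₃ : ℝ, M₃ = 12 * C₁ * max C₂ 0 / (c₃ * D ^ 4 * Vmin ^ 8) + 16 * C₁ ^ 3 * smax ^ 8 / (c₃ * D ^ 12) + 1 := ⟨_, rfl⟩
  have hM₃0 : 0 < M₃ := by rw [hM₃]; positivity
  obtain ⟨δ₂, hδ₂, hK₃δ⟩ := exists_delta_of_tendsto_mul hK₃lim (ε := ℓ / 20) (by positivity)
  obtain ⟨δ₃, hδ₃, hΓ₃δ⟩ := exists_delta_of_tendsto_div_atTop hΓ₃lim M₃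
  obtain ⟨s, hs⟩ : ∃ s : ℝ, s = min δ₂ (min (δ₃ / 2) smax) := ⟨_, rfl⟩
  have hs0 : 0 < s := by rw [hs]; positivity
  have hs₂ : s ≤ δ₂ := hs ▸ min_le_left _ _
  have hs₃ : s ≤ δ₃ / 2 := hs ▸ (min_le_right _ _).trans (min_le_left _ _)
  have hs₄ : s ≤ smax := hs ▸ (min_le_right _ _).trans (min_le_right _ _)
  have hsδ₃ : s < δ₃ := by linarith only [hs₃, hδ₃]
  obtain ⟨hsℓ, hsV, hKt⟩ := scale_boundsI hℓ0 hVmax.le hκ₂0 hs0.le hsmax hs₄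
  -- FC3's growth clause at the scale `s`
  have hK₃t : s * K₃ (s / 2) < ℓ / 10 := by
    have := hK₃δ (s / 2) (by positivity) (by linarith only [hs₂, hs0])
    linarith only [this]
  have hM₃C := M3_bound (C₂p := max C₂ 0) hC₁ hc₃ hD0 hVmin hs0 hs₄
  rw [← hM₃] at hM₃C
  -- the three bumps: plateau radius `δ s / 8`, support radius `δ s / 4`
  have hρ : 0 < δ * s / 8 := by positivity
  obtain ⟨f, hf0, -, hfone, hfsupp, hfts⟩ := exists_bump_schwartz (0 : EuclideanSpace ℝ (Fin 4)) (ρ := δ * s / 8) hρ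
  obtain ⟨g, hg0, -, hgone, hgsupp, hgts⟩ := exists_bump_schwartz (s • v) (ρ := δ * s / 8) hρ
  obtain ⟨h, hh0, -, hhone, hhsupp, hhts⟩ := exists_bump_schwartz (s • w) (ρ := δ * s / 8) hρ
  -- small spacings
  have hn₀0 : (0 : ℝ) < n₀ := by exact_mod_cast hn₀
  obtain ⟨β₀, hβ₀⟩ := exists_of_tendsto_atTop_nhds_zero hlim
    (a₀ := min (min (min (ℓ / 100) (δ * s / 16)) (min (s / 2) (s / ((n₃ : ℝ) + 1))))
      (min (min (δ * s / (2 * (‖v‖ + δ))) (δ * s / (2 * (‖w‖ + δ)))) (s * Vmin / n₀))) (by positivity)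
  refine ⟨f, g, h, c₃ * M₃ / (2 * s ^ 8) * (δ * s / 16) ^ 12, max (max β₀ β₁) (max β₂ β₃), ℓ,
    ?_, ?_, ?_, by positivity, ?_⟩
  · rw [hfts, hgts]
    refine closedBall_disjoint_closedBall ?_
    rw [dist_eq_norm, zero_sub, norm_neg, norm_smul, Real.norm_eq_abs, abs_of_pos hs0]
    linarith only [mul_lt_mul_of_pos_left (show δ / 2 < ‖v‖ by linarith only [h2v, hδ]) hs0]
  · rw [hgts, hhts]
    refine closedBall_disjoint_closedBall ?_
    rw [dist_eq_norm, ← smul_sub, norm_smul, Real.norm_eq_abs, abs_of_pos hs0]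
    linarith only [mul_lt_mul_of_pos_left (show δ / 2 < ‖v - w‖ by linarith only [h2vw, hδ]) hs0]
  · rw [hfts, hhts]
    refine closedBall_disjoint_closedBall ?_
    rw [dist_eq_norm, zero_sub, norm_neg, norm_smul, Real.norm_eq_abs, abs_of_pos hs0]
    linarith only [mul_lt_mul_of_pos_left (show δ / 2 < ‖w‖ by linarith only [h2w, hδ]) hs0]
  intro β hβ L hL
  have hββ₀ : β₀ ≤ β := le_of_max_le_left (le_of_max_le_left hβ)
  have hββ₁ : β₁ ≤ β := le_of_max_le_right (le_of_max_le_left hβ)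
  have hββ₂ : β₂ ≤ β := le_of_max_le_left (le_of_max_le_right hβ)
  have hββ₃ : β₃ ≤ β := le_of_max_le_right (le_of_max_le_right hβ)
  have hα := hapos β
  have hαa₀ := (hβ₀ β hββ₀).le
  have hαℓ : a β ≤ ℓ / 100 := hαa₀.trans ((min_le_left _ _).trans ((min_le_left _ _).trans (min_le_left _ _)))
  have hα16 : a β ≤ δ * s / 16 := hαa₀.trans ((min_le_left _ _).trans ((min_le_left _ _).trans (min_le_right _ _)))
  have hα2 : a β ≤ s / 2 := hαa₀.trans ((min_le_left _ _).trans ((min_le_right _ _).trans (min_le_left _ _)))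
  have hαn₃' : a β ≤ s / ((n₃ : ℝ) + 1) :=
    hαa₀.trans ((min_le_left _ _).trans ((min_le_right _ _).trans (min_le_right _ _)))
  have hαv' : a β ≤ δ * s / (2 * (‖v‖ + δ)) :=
    hαa₀.trans ((min_le_right _ _).trans ((min_le_left _ _).trans (min_le_left _ _)))
  have hαw' : a β ≤ δ * s / (2 * (‖w‖ + δ)) :=
    hαa₀.trans ((min_le_right _ _).trans ((min_le_left _ _).trans (min_le_right _ _)))
  have hαn₀' : a β ≤ s * Vmin / n₀ := hαa₀.trans ((min_le_right _ _).trans (min_le_right _ _))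
  have hαn₃ : ((n₃ : ℝ) + 1) * a β ≤ s := by rw [le_div_iff₀ (by positivity)] at hαn₃'; linarith only [hαn₃']
  have hαv : a β * (‖v‖ + δ) ≤ δ * s / 2 := by rw [le_div_iff₀ (by positivity)] at hαv'; linarith only [hαv']
  have hαw : a β * (‖w‖ + δ) ≤ δ * s / 2 := by rw [le_div_iff₀ (by positivity)] at hαw'; linarith only [hαw']
  have hαn₀ : (n₀ : ℝ) * a β ≤ s * Vmin := by rw [le_div_iff₀ hn₀0] at hαn₀'; linarith only [hαn₀']
  obtain ⟨hfem₁, hfem₂, hfem₃, hL', -⟩ := femto_budget3 (k := (κ₂ : ℝ)) (k₃ := K₃ (s / 2))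
    (L := L) hℓ0.le hℓℓ₁ hℓℓ₂ hℓℓ₃ hKt hK₃t hsV hαℓ hL
  rw [← hD] at hfem₁ hfem₂ hfem₃ hL'
  -- the per-triple floor
  have key : ∀ x y z : Fin 4 → ℤ, f (a β • siteToE x) ≠ 0 → g (a β • siteToE y) ≠ 0 →
      h (a β • siteToE z) ≠ 0 → c₃ * M₃ / (2 * s ^ 8) * a β ^ 12 ≤ σ * torusK3 G r β L x y z := by
    intro x y z hx hy hz
    refine triple_floorI G r a hC₁ hFBLc hU hσ hδ hc₃ hK₃1 hFC3c hs0 hD0 hM₃0.le hVmin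
      hVv hVw hVvw hVv' hVw' hVvw' hΓ₃δ hsδ₃ hM₃C hββ₁ hββ₂ hββ₃ hα hαn₀ hαn₃ hα2 hαv hαw
      hfem₁ hfem₂ hfem₃ hL' x y z ?_ ?_ ?_
    · have := hfsupp _ hx; rw [dist_eq_norm, sub_zero] at this; linarith only [this]
    · have := hgsupp _ hy; rw [dist_eq_norm] at this; linarith only [this]
    · have := hhsupp _ hz; rw [dist_eq_norm] at this; linarith only [this]
  -- Riemann mass of the three plateaux
  have hcov2 : 2 * (s * Vmax) ≤ a β * L := by linarith only [hsV, hL, hℓ0]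
  have hnv : ‖s • v‖ ≤ s * Vmax := by
    rw [norm_smul, Real.norm_eq_abs, abs_of_pos hs0]; exact mul_le_mul_of_nonneg_left (by linarith only [hVv', hδ]) hs0.le
  have hnw : ‖s • w‖ ≤ s * Vmax := by
    rw [norm_smul, Real.norm_eq_abs, abs_of_pos hs0]; exact mul_le_mul_of_nonneg_left (by linarith only [hVw', hδ]) hs0.le
  have hn0 : ‖(0 : EuclideanSpace ℝ (Fin 4))‖ ≤ s * Vmax := by rw [norm_zero]; positivity
  have h2α : 2 * a β ≤ δ * s / 8 := by linarith only [hα16]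
  have hSf : (δ * s / 8 / (2 * a β)) ^ 4 ≤ ∑ x ∈ box 4 L, f (a β • siteToE x) :=
    pow_le_sum_box hf0 hα (fun z hz => hfone z hz) h2α (centre_cover hs0.le hn0 hδV hcov2)
  have hSg : (δ * s / 8 / (2 * a β)) ^ 4 ≤ ∑ y ∈ box 4 L, g (a β • siteToE y) :=
    pow_le_sum_box hg0 hα (fun z hz => hgone z hz) h2α (centre_cover hs0.le hnv hδV hcov2)
  have hSh : (δ * s / 8 / (2 * a β)) ^ 4 ≤ ∑ z ∈ box 4 L, h (a β • siteToE z) :=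
    pow_le_sum_box hh0 hα (fun z hz => hhone z hz) h2α (centre_cover hs0.le hnw hδV hcov2)
  -- summation: `σ Q3 ≥ ε`
  have hsum := mul_sum_mul_sum_mul_sum_le (B := box 4 L) (κ := c₃ * M₃ / (2 * s ^ 8) * a β ^ 12)
    (f := fun x => f (a β • siteToE x)) (g := fun y => g (a β • siteToE y))
    (h := fun z => h (a β • siteToE z)) (C := fun x y z => σ * torusK3 G r β L x y z)
    (fun x => hf0 _) (fun y => hg0 _) (fun z => hh0 _) key
  have hσQ : σ * Q3 G r β L (a β) f g h =
      ∑ x ∈ box 4 L, ∑ y ∈ box 4 L, ∑ z ∈ box 4 L,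
        f (a β • siteToE x) * g (a β • siteToE y) * h (a β • siteToE z) *
          (σ * torusK3 G r β L x y z) := by
    unfold Q3
    rw [Finset.mul_sum]; refine Finset.sum_congr rfl fun x _ => ?_
    rw [Finset.mul_sum]; refine Finset.sum_congr rfl fun y _ => ?_
    rw [Finset.mul_sum]; refine Finset.sum_congr rfl fun z _ => ?_
    ring
  have hσabs : σ * Q3 G r β L (a β) f g h ≤ |Q3 G r β L (a β) f g h| := by
    rcases hσ with rfl | rfl
    · rw [one_mul]; exact le_abs_self _
    · rw [neg_one_mul]; exact neg_le_abs _
  refine le_trans ?_ hσabs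
  rw [hσQ]
  refine le_trans ?_ hsum
  have hα0 : a β ≠ 0 := hα.ne'
  have hpos : (0 : ℝ) ≤ (δ * s / 8 / (2 * a β)) ^ 4 := by positivity
  calc c₃ * M₃ / (2 * s ^ 8) * (δ * s / 16) ^ 12
      = c₃ * M₃ / (2 * s ^ 8) * a β ^ 12 *
          ((δ * s / 8 / (2 * a β)) ^ 4 * (δ * s / 8 / (2 * a β)) ^ 4 * (δ * s / 8 / (2 * a β)) ^ 4) := by
        field_simp; ring
    _ ≤ _ := mul_le_mul_of_nonneg_left (mul_le_mul (mul_le_mul hSf hSg hpos (hpos.trans hSf)) hSh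
        hpos (mul_nonneg (hpos.trans hSf) (hpos.trans hSg))) (by positivity)

end Summit.QuantumFields.YangMills.Cruxes.OSLegsAtWeakCouplingC.InheritedAmplitudeGates.StubLowerI

end
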